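import Summits.QuantumFields.YangMills.Theorems.UnitScaleTiltHistoryTailLaneRowsIntRows
import Summits.QuantumFields.YangMills.Theorems.UnitScaleTiltHistoryTailLaneNumeratorIntRows
import Summits.QuantumFields.YangMills.Theorems.UnitScaleTiltHistoryTailDiluteExponentIntRows
import Summits.QuantumFields.YangMills.Theorems.UnitScaleTiltHistoryTailHistoryMassWIntRows
import Summits.QuantumFields.YangMills.Theorems.UnitScaleTiltHistoryTailLowMassIntRows
import Summits.QuantumFields.YangMills.Theorems.UnitScaleTiltHistoryTailLaneTail
import HarnessLib

/-!
# `UnitScaleTiltHistoryTailLaneTailIntRows` — THE F-2b `Rows` TWIN OF ✓`UnitScaleTiltHistoryTailLaneTailInt` OVER THE ROWS RECORD `AlphaInputsT3AC.PkgCoreRows` (✓`AlphaInputsT3ACv4CoreRows`; ★★OWNER RULING g26-№14 (F-2b),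
# bill v1.2 §7 P18, ★alpha-2 g7 checklist (s1)–(s7)) — crux `HistoryTailL` (stmt-QuantumFields-19936), cell `ym3-torus`, width seat ym-ust-19936-w3 (g5)

WHAT.  `UnitScaleTiltHistoryTailLaneTailInt`'s statements and proofs VERBATIM with `PkgCoreV3 ↦ PkgCoreRows` (the rows record carries the version-4 run rows `runRows : AlphaV4AC.RunAlphaV4CoreAC` —
currency-free (71) per recorded plaquette `h71` in place of the comb (67)-row — so `(q K).runCore ↦ (q K).runRows`), reading the five branch twins (`HistoryTailLaneRowsInt.laneRows_intRows`∕`windowedWeights_int_v5p5ShapeRows`, `HistoryTailLaneNumeratorIntRows.setIntegral_up_le`, `HistoryTailDiluteExponentIntRows.diluteExponent_of_smallFactorIn`, `HistoryTailHistoryMassWIntRows.historyMassBound_of_weights_c`, `HistoryTailLowMassIntRows.lowMass_int_of_one_lt`); declaration names `HistoryTailLaneTailInt.{perPlaquetteHigh_int, perPlaquetteHighL_of_intCoreRec, historyTailL_of_intCoreRec} ↦ HistoryTailLaneTailIntRows.{perPlaquetteHigh_int, perPlaquetteHighL_of_intCoreRecRows, historyTailL_of_intCoreRecRows}`.  The cone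 thus runs
over a FAMILY OF ROWS CORES `q : ∀ K, PkgCoreRows F 𝔠 γ hγ hγ1 K`, fed by the v3 cores (`PkgCoreV3.toRows`, by (69)–(71)) and by the v4 χ-package (`PkgAtV4Chi.toRows`).
THE ORIGINAL'S ACCOUNT (unchanged mathematics, names read with the substitutions above).  `IntCoreRecRows L` (defined in `…HistoryTailIntData`) asks, per profile, for a primitive-constants record and, per family and coupling, a family of data cores `qf : ∀ K, PkgCoreRows …`
with a fixed [Balaban1985Variational] constant `a₁` and the lower a.e. row (47)′ for the INTERIOR datum `dataIntRows qf π` once `θBal ≤ a₁`.  From it: `perPlaquetteHigh_int`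
(the per-plaquette large-field Gibbs tail at the record's profile, every odd `L ≥ 3`: 2″ `laneRows_intRows`, 2‴ `windowedWeights_int_v5p5ShapeRows`, 4c `HistoryTailDiluteExponentIntRows`,
4a `HistoryTailHistoryMassWIntRows`, 4b `HistoryTailLowMassIntRows` (interior radius), the LANDED chessboard `chessboardRP_T3`, Mechanism A `HistoryTailLaneNumeratorIntRows.setIntegral_up_le` +
`HistoryTailLaneNumerator.gibbsK_real_iInter_le`; ONE more coupling threshold than `perPlaquetteHigh_lane`: `θBal ≤ a₁`, `T3Thresholds.exists_gamma_forall_θBal_le`),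
`perPlaquetteHighL_of_intCoreRecRows`, **`historyTailL_of_intCoreRecRows`** (v4's tail chain verbatim).  The χ-record of R-57χ instantiates `IntCoreRecRows` (`…HistoryTailLaneTailV4Chi`).
Nothing of [Balaban1985UV3] is asserted. [cite: Balaban1985UV3, (5) p.256, (41) p.266, (47) p.267, (71) p.273 and Thm 2 p.272; King1986, (3.12) p.657]
HONEST FRAMING.  Bookkeeping twin (renaming + one field read); nothing of [Balaban1985UV3]'s cluster expansion or of [Balaban1985Variational] Thm 1 is proved; CONDITIONAL on
the family of rows cores exactly as the original is on its cores; the v3-typed original stays in the tree unchanged (banked); count-neutral helper toward 2′χ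
(`--supports stmt-QuantumFields-19936`); registry untouched.  YM₃ on the three-torus is rung R3 of the programme, not the Clay problem: nothing here is about d = 4,
infinite volume, or a mass gap.


-/

set_option autoImplicit false

noncomputable section

open MeasureTheory
open Literature.MathematicalPhysics.QuantumFieldTheory.Balaban1983to89
open Literature.MathematicalPhysics.QuantumFieldTheory.Balaban1983to89.T3ContinuumYM3Torus
open Literature.MathematicalPhysics.QuantumFieldTheory.Balaban1983to89.T3UnitScaleTilt
open Literature.MathematicalPhysics.QuantumFieldTheory.Balaban1983to89.T3UnitLawDensityEML
open Literature.MathematicalPhysics.QuantumFieldTheory.Balaban1983to89.T3BareTailProfile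
open Literature.MathematicalPhysics.QuantumFieldTheory.Balaban1983to89.T3ThresholdSmallness (sqrt_coupling_pos_le)
open Literature.MathematicalPhysics.QuantumFieldTheory.Balaban1983to89.T3Thresholds (coupling_le_one)
open Literature.MathematicalPhysics.QuantumFieldTheory.Balaban1983to89.T3AlphaInputsAC
open Literature.MathematicalPhysics.QuantumFieldTheory.Balaban1983to89.T3AlphaInputsACSchemas
open Literature.MathematicalPhysics.QuantumFieldTheory.Balaban1983to89.B10Eq38TorusDomains (toFine)
open Literature.MathematicalPhysics.QuantumFieldTheory.Balaban1983to89.T3RestrictedUnitDensity (resDensity integrable_resDensity)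
open Literature.MathematicalPhysics.QuantumFieldTheory.Balaban1983to89.Missing (partitionFn measurable_plaqHol)
open Summit.QuantumFields.Balaban3D.Carriers (suGroupModel)
open Summit.QuantumFields.Balaban3D.Proofs.Primitives (AlphaConsts)
open Summit.QuantumFields.Balaban3D.Proofs.Run3SmallFactors (regionT src_mem_plaqCover_of_mem_regionT)
open Summit.QuantumFields.YangMills.Theorems
open Summit.QuantumFields.YangMills.Theorems.HistoryTailDensityTransfer (gibbsK_real_preimage_iter_eq)
open Summit.QuantumFields.YangMills.Theorems.HistoryTailSandwich (partitionFn_eq_integral_resDensity)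
open Summit.QuantumFields.YangMills.Theorems.HistoryTailMechanismA (integral_mul_indicator_one_eq_setIntegral)
open Summit.QuantumFields.YangMills.Theorems.HistoryTailAlphaConsumer (setIntegral_div_integral_le_ae)
open Summit.QuantumFields.YangMills.Theorems.HistoryTailLaneRowsInt (laneRows_intRows windowedWeights_int_v5p5ShapeRows)
open Summit.QuantumFields.YangMills.Theorems.HistoryTailLaneNumeratorIntRows (setIntegral_up_le)
open Summit.QuantumFields.YangMills.Theorems.HistoryTailLaneNumerator (gibbsK_real_iInter_le root_bound exponent_bound xlog_mono mass_budget budget_of_c)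

namespace Summit.QuantumFields.YangMills.Theorems.HistoryTailLaneTailIntRows

open Classical

/-- **THE PER-PLAQUETTE HIGH TAIL AT THE RECORD'S PROFILE, every odd `L ≥ 3`, FROM A FAMILY OF DATA CORES WITH THE INTERIOR (47)′ ROW** (v4's `stub_perPlaquetteHighRaw`
conclusion with `(b₀, p₀, r₀) := (𝔠.b₀, 𝔠.p₀, 𝔠.r₀)`): from ONE record `𝔠` and, per family/coupling, data cores with a fixed constant `a₁` (`IntCoreRecRows`'s body at a profile) — the lane's deliverables (STUB 2″), the exponent bound (4c), the history mass
(4a), the minorant mass (4b), the LANDED chessboard `chessboardRP_T3`, Mechanism A on the joint event from the DELIVERED envelopes of the interior datum, the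
|S|-th root, the exponent algebra. [cite: Balaban1985UV3, (5) p.256, (41) p.266, (47) p.267 and (71) p.273] -/
theorem perPlaquetteHigh_int (L : ℕ) (hLo : Odd L) (hL : 1 < L) (𝔠 : AlphaConsts L (suGroupModel 2).N) (a₁ : ℝ) (ha1 : 0 < a₁)
    (h𝔠 : ∀ (F : T3Family) (hF : F.L = L) (γ : ℝ) (hγ : 0 < γ) (hγ1 : γ ≤ (min (hF ▸ 𝔠).gamma0 1) ^ 2),
      ∃ qf : ∀ K, AlphaInputsT3AC.PkgCoreRows F (hF ▸ 𝔠) γ hγ hγ1 K, (∀ K, (qf K).a₁ = a₁) ∧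
        ((∀ i, θBal F.L γ (hF ▸ 𝔠).b₀ (hF ▸ 𝔠).p₀ i ≤ a₁) →
          ∀ (π : AlphaInputsT3AC.PolymerT3 F) (K j : ℕ), j ≤ K → Ineq47AE (AlphaInputsT3AC.dataIntRows qf π) K j)) :
    ∃ κ γ₁ c : ℝ, 0 ≤ κ ∧ 0 < γ₁ ∧ γ₁ ≤ 1 ∧ 0 < c ∧ c ≤ 1 / 4 ∧
      ∀ (F : T3Family) (γ : ℝ), F.L = L → 0 < γ → γ ≤ γ₁ →
        ∃ (j₀ : ℕ) (C : ℝ) (A : ℕ), 0 ≤ C ∧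
          ∀ (K j : ℕ), j₀ < j → j ≤ K → ∀ p : Plaq (F.P K) j,
            (gibbsK F ℰp γ K).real
                {U | θBal F.L γ 𝔠.b₀ 𝔠.p₀ (K - j) ≤
                  GaugeGroup.dist1 (GaugeField.plaqHol
                    (Averaging.iter (fun _ => BlockAveraging.blockAvg ℰp) j U) p)} ≤
              C * (F.scheme ℰp γ).β (K - j) ^ A *
                Real.exp (-(c * B10.pFun 𝔠.b₀ 𝔠.p₀ (Real.sqrt (γ * ((F.L : ℝ)⁻¹) ^ (K - j))) ^ 2) +
                  κ * (1 + Real.log (Real.sqrt (γ * ((F.L : ℝ)⁻¹) ^ (K - j)))⁻¹) ^ (2 + 3 * 𝔠.r₀)) := by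
  -- the constants, all fixed with the record
  obtain ⟨γ₂, cSF, CP, κZ, hγ₂, hcSF0, hcSF4, hCP, hκZ, hLane⟩ := laneRows_intRows L hLo hL 𝔠
  obtain ⟨γw, Bm, hγw, hBm, hWin⟩ := windowedWeights_int_v5p5ShapeRows L hLo hL 𝔠
  have hCT : (0 : ℝ) ≤ Bm := hBm
  set CT : ℝ := Bm with hCTdef
  obtain ⟨ccol, γc, hccol, hγc, h4c⟩ := Summit.QuantumFields.YangMills.Theorems.HistoryTailDiluteExponentIntRows.diluteExponent_of_smallFactorIn L hLo hL 𝔠 cSF hcSF0 hcSF4 κZ hκZ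
  obtain ⟨CM, γa, hCM, hγa, h4a⟩ :=
    Summit.QuantumFields.YangMills.Theorems.HistoryTailHistoryMassWIntRows.historyMassBound_of_weights_c L hLo hL 𝔠 CP hCP Bm hBm
      (cSF * 𝔠.b₀ ^ 2 / 50) (by have := 𝔠.b₀_pos; positivity)
  obtain ⟨CL, γb, hCL, hγb, h4b⟩ := Summit.QuantumFields.YangMills.Theorems.HistoryTailLowMassIntRows.lowMass_int_of_one_lt L hLo hL 𝔠 a₁ ha1 CP hCP
  obtain ⟨γθ, hγθ, hγθ1, hθle⟩ := T3Thresholds.exists_gamma_forall_θBal_le 𝔠.b₀_pos 𝔠.p₀_pos one_pos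
  obtain ⟨γA, hγA, hγA1, hθA⟩ := T3Thresholds.exists_gamma_forall_θBal_le 𝔠.b₀_pos 𝔠.p₀_pos ha1
  have hg0 : 0 < (min 𝔠.gamma0 1) ^ 2 := by have := 𝔠.gamma0_pos; positivity
  set C : ℝ := CM + CP + CT + CL + 1 with hCdef
  have hC0 : 0 ≤ C := by rw [hCdef]; positivity
  have hL0 : (0 : ℝ) ≤ (L : ℝ) := by positivity
  refine ⟨8 * C * (L : ℝ) ^ 3 * (ccol + 4) ^ 3,
    min (min (min (min (min γ₂ γw) γc) (min γa γb)) (min (min γθ ((min 𝔠.gamma0 1) ^ 2)) 1)) γA, cSF, by positivity,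
    by positivity, ((min_le_left _ _).trans (min_le_right _ _)).trans (min_le_right _ _), hcSF0, hcSF4, fun F γ hFL hγ hle' => ?_⟩
  have hle : γ ≤ min (min (min (min γ₂ γw) γc) (min γa γb)) (min (min γθ ((min 𝔠.gamma0 1) ^ 2)) 1) := hle'.trans (min_le_left _ _)
  have hleA : γ ≤ γA := hle'.trans (min_le_right _ _)
  -- thresholds unpacked
  have hle2 : γ ≤ γ₂ := hle.trans ((min_le_left _ _).trans ((min_le_left _ _).trans ((min_le_left _ _).trans (min_le_left _ _))))
  have hlew : γ ≤ γw := hle.trans ((min_le_left _ _).trans ((min_le_left _ _).trans ((min_le_left _ _).trans (min_le_right _ _))))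
  have hlec : γ ≤ γc := hle.trans ((min_le_left _ _).trans ((min_le_left _ _).trans (min_le_right _ _)))
  have hlea : γ ≤ γa := hle.trans ((min_le_left _ _).trans ((min_le_right _ _).trans (min_le_left _ _)))
  have hleb : γ ≤ γb := hle.trans ((min_le_left _ _).trans ((min_le_right _ _).trans (min_le_right _ _)))
  have hleθ : γ ≤ γθ := hle.trans ((min_le_right _ _).trans ((min_le_left _ _).trans (min_le_left _ _)))
  have hleg : γ ≤ (min 𝔠.gamma0 1) ^ 2 := hle.trans ((min_le_right _ _).trans ((min_le_left _ _).trans (min_le_right _ _)))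
  have hγ1 : γ ≤ 1 := hle.trans ((min_le_right _ _).trans (min_le_right _ _))
  subst hFL
  have hL1 : 1 ≤ F.L := F.hL.2.le
  -- the family of data cores of this family, and the interior datum
  obtain ⟨qf, hqa, h47⟩ := h𝔠 F rfl γ hγ hleg
  have hθa : ∀ i, θBal F.L γ 𝔠.b₀ 𝔠.p₀ i ≤ a₁ := fun i => hθA F.L hL1 γ hγ hleA i
  let π : AlphaInputsT3AC.PolymerT3 F := ⟨fun _ _ _ _ => ∅, fun _ _ _ _ => 0, fun _ _ Y => Y, fun _ _ _ => 0⟩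
  obtain ⟨hSF, hPS, hZ⟩ := hLane F rfl γ hγ hleg qf π hle2
  obtain ⟨wt', hw0, hwz, hwAdm, hwI, hPm, h41I⟩ := hWin F rfl γ hγ hleg qf π hlew
  have hExp := h4c F rfl γ hγ hleg qf π hlec hSF hZ
  have hMass := h4a F rfl γ hγ hleg qf π (fun K j r _ Wf => wt' K j r Wf) hlea (fun K j r _ Wf => hw0 K j r Wf)
    (fun K j r _ Wf hra => hwz K j r Wf hra) hPS (fun K j r _ hjK hne => hwAdm K j r hjK (Nat.one_le_iff_ne_zero.mpr fun hj0 => hne (by subst hj0; exact Summit.QuantumFields.Balaban3D.Carriers.Hist.eq_triv_zero r))) (fun K j r _ hjK => hwI K j r hjK)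
    (fun K j r _ hjK => hPm K j r hjK)
  have hLow := h4b F rfl γ hγ hleg qf π hqa hleb hPS
  -- the datum with the windowed weights (regions, minimiser, main term, interaction, Zterm, χ, low, Rm unchanged)
  let D' : AlphaDataT3 F γ := { AlphaInputsT3AC.dataIntRows qf π with
    LF := fun K j Wf Φ => wt' K j (Summit.QuantumFields.Balaban3D.Carriers.Hist.triv (F.P K) j) Wf *
        Real.exp (Φ (Summit.QuantumFields.Balaban3D.Carriers.Hist.triv (F.P K) j)) +
      ∑ r ∈ Finset.univ.erase (Summit.QuantumFields.Balaban3D.Carriers.Hist.triv (F.P K) j),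
        wt' K j r Wf * Real.exp (Φ r) }
  obtain ⟨CRm, hCRm⟩ := exp_two_Rm_le (AlphaInputsT3AC.dataIntRows_rmSize qf π)
  have hCRm0 : 0 ≤ CRm := (Real.exp_pos _).le.trans (hCRm 0 0 le_rfl)
  refine ⟨0, max 1 CRm, 0, le_trans zero_le_one (le_max_left _ _), fun K j hj hjK p => ?_⟩
  have hj1 : 1 ≤ j := hj
  -- names for the scale-`K−j` quantities
  set g : ℝ := Real.sqrt (γ * ((F.L : ℝ)⁻¹) ^ (K - j)) with hg
  set x : ℝ := 1 + Real.log g⁻¹ with hx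
  set θ : ℝ := θBal F.L γ 𝔠.b₀ 𝔠.p₀ (K - j) with hθ
  set N : ℝ := ((F.P K).sitesPerDir j : ℝ) with hN
  have hgpos : 0 < g := (sqrt_coupling_pos_le hL1 hγ (K - j)).1
  have hg1 : g ≤ 1 := coupling_le_one hL1 hγ hγ1 (K - j)
  have hx1 : 1 ≤ x := by
    have : 0 ≤ Real.log g⁻¹ := Real.log_nonneg (one_le_inv_iff₀.mpr ⟨hgpos, hg1⟩)
    linarith
  have hr₀ : 0 ≤ 𝔠.r₀ := zero_le_one.trans 𝔠.one_le_r₀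
  have hxr : 1 ≤ x ^ 𝔠.r₀ := Real.one_le_rpow hx1 hr₀
  have hN1 : 1 ≤ N := by
    rw [hN]; exact_mod_cast Nat.one_le_iff_ne_zero.mpr ((F.P K).sitesPerDir_ne_zero j)
  have hN3 : 1 ≤ N ^ 3 := one_le_pow₀ hN1
  have hxN : 1 ≤ x * N ^ 3 := one_le_mul_of_one_le_of_one_le hx1 hN3
  -- the chessboard family at separation `ρ = ccol·x^{r₀}`
  have hρ1 : 1 ≤ ccol * x ^ 𝔠.r₀ := one_le_mul_of_one_le_of_one_le hccol hxr
  obtain ⟨S, hpS, hsep, hcount, hchess⟩ :=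
    HistoryTailChessboardT3.chessboardRP_T3 F.L hLo hL F γ rfl hγ hγ1 θ K j hjK (ccol * x ^ 𝔠.r₀) hρ1 p
  have hcard : 1 ≤ S.card := Finset.card_pos.mpr ⟨p, hpS⟩
  -- the numerator bound: exponent (4c) + history mass (4a) + trivial mass (2″f) + minorant mass (4b)
  set P4 : ℝ := cSF * B10.pFun 𝔠.b₀ 𝔠.p₀ g ^ 2 with hP4
  set σ : ℕ → ℝ := fun i => cSF * 𝔠.b₀ ^ 2 / 50 *
      (1 + Real.log (Real.sqrt (γ * ((F.L : ℝ)⁻¹) ^ (K - i)))⁻¹) ^ (2 * 𝔠.p₀ - 1) *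
      ((1 + Real.log (Real.sqrt (γ * ((F.L : ℝ)⁻¹) ^ (K - i)))⁻¹) - (1 + Real.log (Real.sqrt (γ * ((F.L : ℝ)⁻¹) ^ (K - j)))⁻¹)) with hσdef
  have hσ0 : ∀ i, i < j → 0 ≤ σ i := by
    intro i hij
    have hxi : 1 ≤ 1 + Real.log (Real.sqrt (γ * ((F.L : ℝ)⁻¹) ^ (K - i)))⁻¹ := hx1.trans (xlog_mono F hγ hij.le)
    have h1 : 0 ≤ (1 + Real.log (Real.sqrt (γ * ((F.L : ℝ)⁻¹) ^ (K - i)))⁻¹) ^ (2 * 𝔠.p₀ - 1) :=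
      Real.rpow_nonneg (zero_le_one.trans hxi) _
    have h2 : 0 ≤ (1 + Real.log (Real.sqrt (γ * ((F.L : ℝ)⁻¹) ^ (K - i)))⁻¹) - (1 + Real.log (Real.sqrt (γ * ((F.L : ℝ)⁻¹) ^ (K - j)))⁻¹) :=
      sub_nonneg.mpr (xlog_mono F hγ hij.le)
    have hb : 0 ≤ cSF * 𝔠.b₀ ^ 2 / 50 := by have := hcSF0.le; positivity
    exact mul_nonneg (mul_nonneg hb h1) h2
  let v₀ : (i : Fin j) → GaugeField (F.P K) i (Matrix.specialUnitaryGroup (Fin 2) ℂ) := fun _ => 1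
  set Pz : ℝ := CP * θBal F.L γ 𝔠.b₀ 𝔠.p₀ (K - j + 1) ^ 2 * N ^ 3 with hPz
  have hθ1 : θBal F.L γ 𝔠.b₀ 𝔠.p₀ (K - j + 1) ≤ 1 := hθle F.L hL1 γ hγ hleθ (K - j + 1)
  have hθ0' : 0 ≤ θBal F.L γ 𝔠.b₀ 𝔠.p₀ (K - j + 1) :=
    (T3MinimiserStabilityReduction.θBal_pos hL1 hγ hγ1 𝔠.b₀_pos 𝔠.p₀ (K - j + 1)).le
  have hPzle : Pz ≤ CP * (x * N ^ 3) := by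
    have hsq : θBal F.L γ 𝔠.b₀ 𝔠.p₀ (K - j + 1) ^ 2 ≤ 1 := pow_le_one₀ hθ0' hθ1
    have hN30 : 0 ≤ N ^ 3 := zero_le_one.trans hN3
    calc Pz = CP * (θBal F.L γ 𝔠.b₀ 𝔠.p₀ (K - j + 1) ^ 2 * N ^ 3) := by rw [hPz]; ring
      _ ≤ CP * (1 * N ^ 3) := mul_le_mul_of_nonneg_left (mul_le_mul_of_nonneg_right hsq hN30) hCP
      _ ≤ CP * (x * N ^ 3) := mul_le_mul_of_nonneg_left (mul_le_mul_of_nonneg_right hx1 hN30) hCP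
  have h2le : Bm ≤ Real.exp (CT * x * N ^ 3) := by
    calc Bm ≤ Bm + 1 := by linarith
      _ ≤ Real.exp Bm := Real.add_one_le_exp Bm
      _ ≤ Real.exp (CT * x * N ^ 3) := Real.exp_le_exp.mpr (by rw [hCTdef]; nlinarith [hxN, hBm])
  have hnumer := setIntegral_up_le qf π K j S θ P4 (Real.exp (CM * x * N ^ 3)) (Real.exp (CT * x * N ^ 3)) Pz σ hσ0
    (fun r Wf => wt' K j r Wf) (fun r Wf => hw0 K j r Wf)
    (AlphaDataT3.up D' K j) (wt' K j (Summit.QuantumFields.Balaban3D.Carriers.Hist.triv (F.P K) j))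
    (fun Wf => hw0 K j _ Wf) (fun Wf => rfl)
    (fun r Wf hadm hWE => hExp K j hjK r v₀ Wf hadm S hWE hsep)
    (fun r _ => hwAdm K j r hjK hj1) (hwAdm K j _ hjK hj1)
    (fun r Wf hadm => (abs_le.mp (hPS K j r Wf hjK hj1 hadm)).2)
    (hMass K j hjK v₀) ⟨(hwI K j _ hjK).1, (hwI K j _ hjK).2.trans h2le⟩
    (h41I K j hjK).2
  -- the bound `B` against `∫ low`
  have hlowmass : Real.exp (-(CL * x * N ^ 3)) ≤
      ∫ Wf, (AlphaInputsT3AC.dataIntRows qf π).low K j Wf ∂fieldMeasure (F.P K) j (Matrix.specialUnitaryGroup (Fin 2) ℂ) := hLow K j hjK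
  have hB := mass_budget (c := (S.card : ℝ) * P4) hCM hCP hCT hxN hPzle hlowmass
  have hnum := hnumer.trans hB
  -- Mechanism A on the joint event from the DELIVERED envelopes
  have h47' : Ineq47AE D' K j := h47 hθa π K j hjK
  have hreg' : EnvelopeRegular D' K j :=
    ⟨AlphaInputsT3AC.dataIntRows_integrable_low qf π K j hjK, (h41I K j hjK).2, AlphaInputsT3AC.dataIntRows_integral_low_pos qf π K j hjK⟩
  have hinter := gibbsK_real_iInter_le (D := D') hγ.le hjK (h41I K j hjK).1 h47' hreg'
    (fun Wf => T3AlphaInputsAC.low_nonneg (AlphaInputsT3AC.dataIntRows_chiRange qf π) K j Wf) S θ _ hnum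
  have hB2 : (gibbsK F ℰp γ K).real
        {U | ∀ q ∈ S, θ ≤ GaugeGroup.dist1 (GaugeField.plaqHol
          (Averaging.iter (fun _ => BlockAveraging.blockAvg ℰp) j U) q)} ≤
      CRm * Real.exp (-((S.card : ℝ) * P4) + (CM + CP + CT + CL + 1) * x * N ^ 3) :=
    hinter.trans (mul_le_mul_of_nonneg_right (hCRm K j hjK) (Real.exp_nonneg _))
  -- the root and the exponent
  have hE_eq : -((S.card : ℝ) * P4) + (CM + CP + CT + CL + 1) * x * N ^ 3 = -P4 * (S.card : ℝ) + C * x * N ^ 3 := by rw [hCdef]; ring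
  rw [hE_eq] at hB2
  have hroot := root_bound (E := -P4 * (S.card : ℝ) + C * x * N ^ 3) hcard measureReal_nonneg hCRm0 hchess hB2
  have hcount' : N ^ 3 ≤ (S.card : ℝ) * (8 * ((F.L : ℝ) * (ccol * x ^ 𝔠.r₀ + 4)) ^ 3) := by rw [hN]; exact hcount
  have hexp := exponent_bound (P4 := P4) (C := C) hcard hC0 hx1 hL0 hccol hr₀ hcount'
  have hfinal : max 1 CRm * Real.exp ((-P4 * (S.card : ℝ) + C * x * N ^ 3) / S.card) ≤
      max 1 CRm * Real.exp (-P4 + 8 * C * (F.L : ℝ) ^ 3 * (ccol + 4) ^ 3 * x ^ (2 + 3 * 𝔠.r₀)) :=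
    mul_le_mul_of_nonneg_left (Real.exp_le_exp.mpr hexp) (le_trans zero_le_one (le_max_left _ _))
  calc (gibbsK F ℰp γ K).real
          {U | θ ≤ GaugeGroup.dist1 (GaugeField.plaqHol (Averaging.iter (fun _ => BlockAveraging.blockAvg ℰp) j U) p)}
        ≤ max 1 CRm * Real.exp (-P4 + 8 * C * (F.L : ℝ) ^ 3 * (ccol + 4) ^ 3 * x ^ (2 + 3 * 𝔠.r₀)) := hroot.trans hfinal
    _ = max 1 CRm * (F.scheme ℰp γ).β (K - j) ^ 0 *
          Real.exp (-(cSF * B10.pFun 𝔠.b₀ 𝔠.p₀ g ^ 2) + 8 * C * (F.L : ℝ) ^ 3 * (ccol + 4) ^ 3 * x ^ (2 + 3 * 𝔠.r₀)) := by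
          rw [pow_zero, mul_one, hP4]

/-- **THE PER-PLAQUETTE HIGH TAIL, THRESHOLD FORM** (v4's `stub_perPlaquetteHighRaw` text with the profile chosen beyond given thresholds): for EVERY odd `L ≥ 3` from
`IntCoreRecRows`'s records at the profile `(max b₁ b₁′, max p₁ p₁′)` and `perPlaquetteHigh_int` (no small-block residue). [cite: Balaban1985UV3, (5) p.256 and (71) p.273] -/
theorem perPlaquetteHighL_of_intCoreRecRows (hrec : ∀ L : ℕ, Odd L → 1 < L → AlphaInputsT3AC.IntCoreRecRows L) :
    ∀ (L : ℕ), Odd L → 1 < L → ∀ (b₁ p₁ : ℝ),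
      ∃ b₀ p₀ r₀ κ c : ℝ, b₁ ≤ b₀ ∧ p₁ ≤ p₀ ∧ 0 < b₀ ∧ 2 < p₀ ∧ 0 ≤ r₀ ∧ 0 ≤ κ ∧ 1 + 3 * r₀ / 2 < p₀ ∧ 0 < c ∧ c ≤ 1 / 4 ∧
        ∃ γ₁ : ℝ, 0 < γ₁ ∧ γ₁ ≤ 1 ∧
          ∀ (F : T3Family) (γ : ℝ), F.L = L → 0 < γ → γ ≤ γ₁ →
            ∃ (j₀ : ℕ) (C : ℝ) (A : ℕ), 0 ≤ C ∧
              ∀ (K j : ℕ), j₀ < j → j ≤ K → ∀ p : Plaq (F.P K) j,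
                (gibbsK F ℰp γ K).real
                    {U | θBal F.L γ b₀ p₀ (K - j) ≤
                      GaugeGroup.dist1 (GaugeField.plaqHol
                        (Averaging.iter (fun _ => BlockAveraging.blockAvg ℰp) j U) p)} ≤
                  C * (F.scheme ℰp γ).β (K - j) ^ A *
                    Real.exp (-(c * B10.pFun b₀ p₀ (Real.sqrt (γ * ((F.L : ℝ)⁻¹) ^ (K - j))) ^ 2) +
                      κ * (1 + Real.log (Real.sqrt (γ * ((F.L : ℝ)⁻¹) ^ (K - j)))⁻¹) ^ (2 + 3 * r₀)) := by
  intro L hLo hL b₁ p₁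
  obtain ⟨b₁', p₁', hrec'⟩ := hrec L hLo hL
  obtain ⟨𝔠, a₁, hcb, hcp, ha1, h𝔠⟩ := hrec' (max b₁ b₁') (max p₁ p₁') (le_max_right _ _) (le_max_right _ _)
  obtain ⟨κ, γ₁, c, hκ, hγ₁, hγ₁1, hc0, hc4, hhigh⟩ := perPlaquetteHigh_int L hLo hL 𝔠 a₁ ha1 h𝔠
  have hr₀ : 0 ≤ 𝔠.r₀ := zero_le_one.trans 𝔠.one_le_r₀
  have hp : 1 + 3 * 𝔠.r₀ / 2 < 𝔠.p₀ := by
    have := 𝔠.one_le_r₀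
    show 1 + 3 * 𝔠.r₀ / 2 < 2 * 𝔠.r₀ + 1
    linarith
  refine ⟨𝔠.b₀, 𝔠.p₀, 𝔠.r₀, κ, c, hcb ▸ le_max_left _ _, hcp ▸ le_max_left _ _, 𝔠.b₀_pos, 𝔠.two_lt_p₀, hr₀, hκ, hp, hc0, hc4,
    γ₁, hγ₁, hγ₁1, hhigh⟩

/-- **`HistoryTailL ⇐ IntCoreRecRows` (the record-free interior socket) ALONE**: `perPlaquetteHighL_of_intCoreRecRows` + v4's LANDED tail chain (`budget_of_c`,
`HistoryTailBoundedHeight.perPlaquette_of_split`, `HistoryTailBirthV3b.stub_tailOfPerPlaquette`, `historyTailAt_of_averagedTailAt`) ⇒ the load-bearing item stmt-QuantumFields-19936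
BY NAME, CONDITIONALLY; the profile is fixed BEFORE the free top fraction `m`. [cite: Balaban1985UV3, (5) p.256 and (71) p.273; King1986, (3.12) p.657] -/
theorem historyTailL_of_intCoreRecRows (hrec : ∀ L : ℕ, Odd L → 1 < L → AlphaInputsT3AC.IntCoreRecRows L) :
    Summit.QuantumFields.YangMills.Theses.UnitScaleTilt.HistoryTailL := by
  intro L b₁ p₁
  by_cases hL : Odd L ∧ 1 < L
  · obtain ⟨b₀, p₀, r₀, κ, cSF, hb1, hp1, hb, hp2, hr₀, hκ, hp, hc0, -, γ₁, hγ₁, hγ₁1, h⟩ := perPlaquetteHighL_of_intCoreRecRows hrec L hL.1 hL.2 b₁ p₁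
    obtain ⟨C₆, c, hC₆, hc, hbud⟩ := budget_of_c b₀ p₀ r₀ κ cSF hb hr₀ hκ hp hc0
    refine ⟨b₀, p₀, hb1, hp1, hb, hp2, fun m hm => ⟨γ₁, hγ₁, fun F γ hFL hγ hle => ?_⟩⟩
    have hγ1 : γ ≤ 1 := hle.trans hγ₁1
    have hp01 : (1 : ℝ) ≤ p₀ := by linarith
    have hL1 : 1 ≤ F.L := F.hL.2.le
    obtain ⟨j₀, C, A, hC, hhigh⟩ := h F γ hFL hγ hle
    have hhigh' : ∃ (C : ℝ) (A : ℕ) (c : ℝ), 0 ≤ C ∧ 0 < c ∧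
        ∀ (K j : ℕ), j₀ < j → j ≤ K → ∀ p : Plaq (F.P K) j,
          (gibbsK F ℰp γ K).real
              {U | θBal F.L γ b₀ p₀ (K - j) ≤
                GaugeGroup.dist1 (GaugeField.plaqHol
                  (Averaging.iter (fun _ => BlockAveraging.blockAvg ℰp) j U) p)} ≤
            C * (F.scheme ℰp γ).β (K - j) ^ A *
              Real.exp (-(c * B10.pFun b₀ p₀ (Real.sqrt (γ * ((F.L : ℝ)⁻¹) ^ (K - j))) ^ 2)) := by
      refine ⟨C * C₆, A, c, mul_nonneg hC hC₆, hc, fun K j hj hjK p => ?_⟩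
      have hg := sqrt_coupling_pos_le hL1 hγ (K - j)
      have hg1 := coupling_le_one hL1 hγ hγ1 (K - j)
      have hβA : 0 ≤ C * (F.scheme ℰp γ).β (K - j) ^ A :=
        mul_nonneg hC (pow_nonneg (F.scheme_β_nonneg ℰp hγ.le (K - j)) A)
      calc (gibbsK F ℰp γ K).real
              {U | θBal F.L γ b₀ p₀ (K - j) ≤
                GaugeGroup.dist1 (GaugeField.plaqHol
                  (Averaging.iter (fun _ => BlockAveraging.blockAvg ℰp) j U) p)}
            ≤ C * (F.scheme ℰp γ).β (K - j) ^ A *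
                Real.exp (-(cSF * B10.pFun b₀ p₀ (Real.sqrt (γ * ((F.L : ℝ)⁻¹) ^ (K - j))) ^ 2) +
                  κ * (1 + Real.log (Real.sqrt (γ * ((F.L : ℝ)⁻¹) ^ (K - j)))⁻¹) ^ (2 + 3 * r₀)) := hhigh K j hj hjK p
        _ ≤ C * (F.scheme ℰp γ).β (K - j) ^ A *
                (C₆ * Real.exp (-(c * B10.pFun b₀ p₀ (Real.sqrt (γ * ((F.L : ℝ)⁻¹) ^ (K - j))) ^ 2))) :=
              mul_le_mul_of_nonneg_left (hbud _ hg.1 hg1) hβA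
        _ = C * C₆ * (F.scheme ℰp γ).β (K - j) ^ A *
                Real.exp (-(c * B10.pFun b₀ p₀ (Real.sqrt (γ * ((F.L : ℝ)⁻¹) ^ (K - j))) ^ 2)) := by ring
    have hPP := HistoryTailBoundedHeight.perPlaquette_of_split j₀ F hγ hγ1 hb.le p₀ hhigh'
    exact historyTailAt_of_averagedTailAt F hγ hγ1 hb hp01 hm
      (HistoryTailBirthV3b.stub_tailOfPerPlaquette F γ b₀ p₀ hγ hγ1 hb hp01 hPP)
  · refine ⟨max b₁ 1, max p₁ 3, le_max_left _ _, le_max_left _ _, lt_of_lt_of_le one_pos (le_max_right _ _),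
      lt_of_lt_of_le (by norm_num) (le_max_right _ _), fun m _ => ⟨1, one_pos, fun F γ hFL _ _ => ?_⟩⟩
    have hF := F.hL
    rw [hFL] at hF
    exact (hL hF).elim

end Summit.QuantumFields.YangMills.Theorems.HistoryTailLaneTailIntRows
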